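import Summits.QuantumFields.BalabanUV.Beta.CompositeVertexKernelBounds
import Summits.QuantumFields.BalabanUV.Beta.CompositeVertexKernelRecTwo
import Summits.QuantumFields.BalabanUV.Beta.CompositeVertexKernelCongr
import Summits.QuantumFields.BalabanUV.Beta.SymAveragingMixedJetTables
import Literature.MathematicalPhysics.QuantumFieldTheory.Balaban1983to89.Beta.BalabanCompositeJets

/-!
# `BalabanUV.Beta.CompositeVertexKernelBoundsTwo` — row D1 ∕ (C1), file F5 (brick-generic), part 2: BOUND, PACKING, BI-LOCALITY, COVARIANCE
# AND THE TWO INSTANTIATIONS of the composite second-order border kernel `compVH2Ker` of `CompositeVertexKernelRecTwo`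

WHAT.  §1 bound `abs_compVH2Ker_le` (`bndVH2`); §2 packing `compVh2S … m κ u := packVH (fun μ y f f′ => compVH2Ker … f (κ,u) f′) (L^m)`,
window-generic `biLoc_packVH₂_of_window` (an1's `biLoc_vh₂SAt`), (LB) `locStencil₂_compVh2S`, congruence `compVH2Ker_congr ∕ compVh2S_congr` (leaf-02 W-7 (W2));
§3 (TB) `packVH₂_translate ∕ compVh2S_translate`; §4 the (R) rooted ∕ (S) symmetrised instantiations (`compVh2S_rooted_one = vh₂SAt`, `compVh2S_sym_one = symVh₂SAt`, (LB)(TB)).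

[folklore] finite sums ∕ inductions over OUR typed objects + an1's brick letters BY NAME; two [our object ∕ bookkeeping] definitions (`bndVH2`, `compVh2S`).
Nothing of Bałaban's asserted, valued or discharged; 0 estimates; 0∕4 row-D1 binders; NOT (C1), NOT D1, NEVER «G-an2-4 closed», NOT BetaPertH, NOT
continuum, NOT Clay.

HONEST DEPENDENCY (page 1, mandatory): continuum YM on T⁴ ⇐ BetaPertH ∧ nine spine estimates (0/9 proved); BetaPertH ⇐ (D1) ∧ (D4) ∧ CAP+tail;
G-an2-4 gates asym, D1 and NE2/3/4.  Row D1 ∕ (C1) OWNER an2, gen 50, 2026-08-23.  No existing file touched.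
-/

noncomputable section

open scoped BigOperators
namespace Summit.QuantumFields.BalabanUV.Beta.CompositeVertexKernelRec

open Finset
open Literature.MathematicalPhysics.QuantumFieldTheory.Balaban1983to89
open Literature.MathematicalPhysics.QuantumFieldTheory.Balaban1983to89.Beta
open AffineAveraging (Site box toSite)
open AveragingContours (blk off)
open AveragingHessianKernels (Bond Near packVH ell)
open AveragingHessianKernelsRooted (linKerAt vhKerAt)
open AveragingMixedJetTables (vh2KerAt vh₂SAt vh2Abs)
open SymAveragingHessianCounts (symLinKerAt symVhKerAt)
open SymAveragingMixedJetTables (symVh2KerAt symVh₂SAt symVh2Abs)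
open ExpKernelCalculus (MKer BiLoc shiftK)
open OneStepResolventKernel (Fib)
open BalabanCompositeJets (LocStencil₂)
open B12Sec2to5 (l1 l1_nonneg)

variable {d : ℕ}
variable {ℓ : ℕ → Fin (d + 1) → Site (d + 1) → Bond (d + 1) → ℝ}
  {𝓋 : ℕ → Fin (d + 1) → Site (d + 1) → Bond (d + 1) → Bond (d + 1) → ℝ}
  {𝓋₂ : ℕ → Fin (d + 1) → Site (d + 1) → Bond (d + 1) → Bond (d + 1) → Bond (d + 1) → ℝ} {L : ℕ}

/-! ## §1 Bound by induction -/

/-- [our object — bookkeeping] The recursive bound of the composite second-order border kernel (`D = (d+1)(2L)^{d+1}`, `Cℓ = D·Bℓ`):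
`bndVH2 0 = 0`, `bndVH2 (m+1) = D³·B𝓋₂·Cℓ^{3m} + 2·D²·B𝓋·bndVH m·Cℓ^m + D·Bℓ·bndVH2 m`. -/
def bndVH2 (d L : ℕ) (Bℓ B𝓋 B𝓋₂ : ℝ) : ℕ → ℝ
  | 0 => 0
  | m + 1 =>
      (((d : ℝ) + 1) * (2 * (L : ℝ)) ^ (d + 1)) ^ 3 * B𝓋₂ * ((((d : ℝ) + 1) * (2 * (L : ℝ)) ^ (d + 1) * Bℓ) ^ m) ^ 3
        + 2 * (((d : ℝ) + 1) * (2 * (L : ℝ)) ^ (d + 1)) ^ 2 * B𝓋 * bndVH d L Bℓ B𝓋 m * (((d : ℝ) + 1) * (2 * (L : ℝ)) ^ (d + 1) * Bℓ) ^ m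
        + ((d : ℝ) + 1) * (2 * (L : ℝ)) ^ (d + 1) * Bℓ * bndVH2 d L Bℓ B𝓋 B𝓋₂ m

/-- [folklore] `0 ≤ bndVH2`. -/
theorem bndVH2_nonneg {Bℓ B𝓋 B𝓋₂ : ℝ} (hB : 0 ≤ Bℓ) (hB' : 0 ≤ B𝓋) (hB'' : 0 ≤ B𝓋₂) : ∀ m, 0 ≤ bndVH2 d L Bℓ B𝓋 B𝓋₂ m
  | 0 => le_rfl
  | m + 1 => by
      have h : 0 ≤ bndVH2 d L Bℓ B𝓋 B𝓋₂ m := bndVH2_nonneg hB hB' hB'' m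
      have h' : 0 ≤ bndVH d L Bℓ B𝓋 m := bndVH_nonneg hB hB' m
      show 0 ≤ (((d : ℝ) + 1) * (2 * (L : ℝ)) ^ (d + 1)) ^ 3 * B𝓋₂ * ((((d : ℝ) + 1) * (2 * (L : ℝ)) ^ (d + 1) * Bℓ) ^ m) ^ 3
        + 2 * (((d : ℝ) + 1) * (2 * (L : ℝ)) ^ (d + 1)) ^ 2 * B𝓋 * bndVH d L Bℓ B𝓋 m * (((d : ℝ) + 1) * (2 * (L : ℝ)) ^ (d + 1) * Bℓ) ^ m
        + ((d : ℝ) + 1) * (2 * (L : ℝ)) ^ (d + 1) * Bℓ * bndVH2 d L Bℓ B𝓋 B𝓋₂ m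
      positivity

/-- [folklore] BOUND ON THE COMPOSITE SECOND-ORDER BORDER KERNEL: `|compVH2Ker m| ≤ bndVH2 m`. -/
theorem abs_compVH2Ker_le {Bℓ B𝓋 B𝓋₂ : ℝ} (hB : 0 ≤ Bℓ) (hB' : 0 ≤ B𝓋) (hB'' : 0 ≤ B𝓋₂) (hℓb : ∀ m μ y f, |ℓ m μ y f| ≤ Bℓ)
    (h𝓋b : ∀ m μ y f f', |𝓋 m μ y f f'| ≤ B𝓋) (h𝓋₂b : ∀ m μ y g g' g'', |𝓋₂ m μ y g g' g''| ≤ B𝓋₂) :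
    ∀ (m : ℕ) (μ : Fin (d + 1)) (y : Site (d + 1)) (f b b' : Bond (d + 1)),
      |compVH2Ker ℓ 𝓋 𝓋₂ L m μ y f b b'| ≤ bndVH2 d L Bℓ B𝓋 B𝓋₂ m
  | 0, _, _, _, _, _ => by rw [compVH2Ker_zero, abs_zero]; exact le_rfl
  | m + 1, μ, y, f, b, b' => by
      rw [compVH2Ker_succ]
      set D := ((d : ℝ) + 1) * (2 * (L : ℝ)) ^ (d + 1) with hD
      set C := ((d : ℝ) + 1) * (2 * (L : ℝ)) ^ (d + 1) * Bℓ with hC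
      have hCm : 0 ≤ C ^ m := pow_nonneg (by positivity) m
      have hIH := abs_compVH2Ker_le hB hB' hB'' hℓb h𝓋b h𝓋₂b m
      have hb2 := bndVH2_nonneg (d := d) (L := L) hB hB' hB'' m
      have hb1 := bndVH_nonneg (d := d) (L := L) hB hB' m
      have hK := abs_compVHKer_le (ℓ := ℓ) (𝓋 := 𝓋) (L := L) hB hB' hℓb h𝓋b m
      have hL1 := abs_compLinKer_le (ℓ := ℓ) (L := L) hB hℓb m
      have S1 : |∑ κ : Fin (d + 1), ∑ e ∈ offs L, ∑ κ' : Fin (d + 1), ∑ e' ∈ offs L, ∑ κ'' : Fin (d + 1), ∑ e'' ∈ offs L,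
          𝓋₂ m μ y (κ, (L : ℤ) • y + e) (κ', (L : ℤ) • y + e') (κ'', (L : ℤ) • y + e'')
            * compLinKer ℓ L m f (κ, (L : ℤ) • y + e) * compLinKer ℓ L m b (κ', (L : ℤ) • y + e')
            * compLinKer ℓ L m b' (κ'', (L : ℤ) • y + e'')|
          ≤ D ^ 3 * B𝓋₂ * (C ^ m) ^ 3 := by
        calc _ ≤ ∑ κ : Fin (d + 1), ∑ e ∈ offs L, ∑ κ' : Fin (d + 1), ∑ e' ∈ offs L, ∑ κ'' : Fin (d + 1), ∑ e'' ∈ offs L,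
                B𝓋₂ * C ^ m * C ^ m * C ^ m := by
              refine (Finset.abs_sum_le_sum_abs _ _).trans (Finset.sum_le_sum fun κ _ => ?_)
              refine (Finset.abs_sum_le_sum_abs _ _).trans (Finset.sum_le_sum fun e _ => ?_)
              refine (Finset.abs_sum_le_sum_abs _ _).trans (Finset.sum_le_sum fun κ' _ => ?_)
              refine (Finset.abs_sum_le_sum_abs _ _).trans (Finset.sum_le_sum fun e' _ => ?_)
              refine (Finset.abs_sum_le_sum_abs _ _).trans (Finset.sum_le_sum fun κ'' _ => ?_)
              refine (Finset.abs_sum_le_sum_abs _ _).trans (Finset.sum_le_sum fun e'' _ => ?_)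
              rw [abs_mul, abs_mul, abs_mul]
              exact mul_le_mul (mul_le_mul (mul_le_mul (h𝓋₂b _ _ _ _ _ _) (hL1 _ _) (abs_nonneg _) hB'') (hL1 _ _)
                (abs_nonneg _) (mul_nonneg hB'' hCm)) (hL1 _ _) (abs_nonneg _) (mul_nonneg (mul_nonneg hB'' hCm) hCm)
          _ = D ^ 3 * B𝓋₂ * (C ^ m) ^ 3 := by
              simp only [Finset.sum_const, Finset.card_univ, Fintype.card_fin, nsmul_eq_mul, card_offs]
              rw [hD]; push_cast; ring
      have S2 : ∀ c c' : Bond (d + 1), |∑ κ : Fin (d + 1), ∑ e ∈ offs L, ∑ κ'' : Fin (d + 1), ∑ e'' ∈ offs L,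
          𝓋 m μ y (κ, (L : ℤ) • y + e) (κ'', (L : ℤ) • y + e'')
            * compVHKer ℓ 𝓋 L m κ ((L : ℤ) • y + e) f c * compLinKer ℓ L m c' (κ'', (L : ℤ) • y + e'')|
          ≤ D ^ 2 * B𝓋 * bndVH d L Bℓ B𝓋 m * C ^ m := by
        intro c c'
        calc _ ≤ ∑ κ : Fin (d + 1), ∑ e ∈ offs L, ∑ κ'' : Fin (d + 1), ∑ e'' ∈ offs L, B𝓋 * bndVH d L Bℓ B𝓋 m * C ^ m := by
              refine (Finset.abs_sum_le_sum_abs _ _).trans (Finset.sum_le_sum fun κ _ => ?_)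
              refine (Finset.abs_sum_le_sum_abs _ _).trans (Finset.sum_le_sum fun e _ => ?_)
              refine (Finset.abs_sum_le_sum_abs _ _).trans (Finset.sum_le_sum fun κ'' _ => ?_)
              refine (Finset.abs_sum_le_sum_abs _ _).trans (Finset.sum_le_sum fun e'' _ => ?_)
              rw [abs_mul, abs_mul]
              exact mul_le_mul (mul_le_mul (h𝓋b _ _ _ _ _) (hK _ _ _ _) (abs_nonneg _) hB') (hL1 _ _) (abs_nonneg _)
                (mul_nonneg hB' hb1)
          _ = D ^ 2 * B𝓋 * bndVH d L Bℓ B𝓋 m * C ^ m := by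
              simp only [Finset.sum_const, Finset.card_univ, Fintype.card_fin, nsmul_eq_mul, card_offs]
              rw [hD]; push_cast; ring
      have S4 : |∑ κ : Fin (d + 1), ∑ e ∈ offs L, ℓ m μ y (κ, (L : ℤ) • y + e) * compVH2Ker ℓ 𝓋 𝓋₂ L m κ ((L : ℤ) • y + e) f b b'|
          ≤ D * Bℓ * bndVH2 d L Bℓ B𝓋 B𝓋₂ m := by
        calc _ ≤ ∑ κ : Fin (d + 1), ∑ e ∈ offs L, Bℓ * bndVH2 d L Bℓ B𝓋 B𝓋₂ m := by
              refine (Finset.abs_sum_le_sum_abs _ _).trans (Finset.sum_le_sum fun κ _ => ?_)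
              refine (Finset.abs_sum_le_sum_abs _ _).trans (Finset.sum_le_sum fun e _ => ?_)
              rw [abs_mul]
              exact mul_le_mul (hℓb _ _ _ _) (hIH _ _ _ _ _) (abs_nonneg _) hB
          _ = D * Bℓ * bndVH2 d L Bℓ B𝓋 B𝓋₂ m := by
              simp only [Finset.sum_const, Finset.card_univ, Fintype.card_fin, nsmul_eq_mul, card_offs]
              rw [hD]; push_cast; ring
      refine le_trans (abs_add_le _ _) ?_
      refine le_trans (add_le_add (abs_add_three _ _ _) le_rfl) ?_
      refine (add_le_add (add_le_add (add_le_add S1 (S2 b b')) (S2 b' b)) S4).trans (le_of_eq ?_)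
      rw [hD, hC]; show _ = _ + _ + _; ring

/-! ## §2 The packed family and its bi-locality -/

variable (ℓ 𝓋 𝓋₂ L) in
/-- [our object — bookkeeping] **THE PACKED COMPOSITE SECOND-ORDER FAMILY AT BLOCKING `L^m`** (an1's `vh₂SAt` packing: the first background
bond `(κ, u)` closed over, node 7a's packer on the rest). -/
def compVh2S (m : ℕ) (κ : Fin (d + 1)) (u : Site (d + 1)) : Fin (d + 1) → Site (d + 1) → MKer (d + 1) (Fib d) :=
  packVH (fun μ y f f' => compVH2Ker ℓ 𝓋 𝓋₂ L m μ y f (κ, u) f') (L ^ m)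

/-- [folklore] **A SECOND-ORDER KERNEL FAMILY SUPPORTED IN SCALE-`N` WINDOWS OF WIDTH `W` (all three bond slots) AND BOUNDED BY `C` PACKS TO A
`LocStencil₂` BODY** at every rate `δ ≥ 0`: `BiLoc (S₂ κ u κ′ u′) u u (C·e^{3(d+1)Wδ}·e^{−δ|u′−u|₁}) δ` (an1's `biLoc_vh₂SAt`, window-generic). -/
theorem biLoc_packVH₂_of_window (K₂ : Fin (d + 1) → Site (d + 1) → Bond (d + 1) → Bond (d + 1) → Bond (d + 1) → ℝ)
    {N : ℕ} (hN : 1 ≤ N) (W : ℕ) {C : ℝ} (hC : 0 ≤ C)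
    (h₁ : ∀ μ y f g h, f.2 ∉ winF N W y → K₂ μ y f g h = 0) (h₂ : ∀ μ y f g h, g.2 ∉ winF N W y → K₂ μ y f g h = 0)
    (h₃ : ∀ μ y f g h, h.2 ∉ winF N W y → K₂ μ y f g h = 0) (hb : ∀ μ y f g h, |K₂ μ y f g h| ≤ C) {δ : ℝ} (hδ : 0 ≤ δ)
    (κ : Fin (d + 1)) (u : Site (d + 1)) (κ' : Fin (d + 1)) (u' : Site (d + 1)) :
    BiLoc (packVH (fun μ y f f' => K₂ μ y f (κ, u) f') N κ' u') u u
      (C * Real.exp (3 * ((d : ℝ) + 1) * W * δ) * Real.exp (-δ * l1 (u' - u))) δ := by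
  intro x z a b
  have hpos : 0 ≤ C * Real.exp (3 * ((d : ℝ) + 1) * W * δ) * Real.exp (-δ * l1 (u' - u))
      * Real.exp (-δ * (l1 (x - u) + l1 (z - u))) :=
    mul_nonneg (mul_nonneg (mul_nonneg hC (Real.exp_pos _).le) (Real.exp_pos _).le) (Real.exp_pos _).le
  have key : ∀ (x z : Site (d + 1)) (μ α : Fin (d + 1)), AveragingContours.off N z = 0 →
      |K₂ μ (AveragingContours.blk N z) (α, x) (κ, u) (κ', u')|
        ≤ C * Real.exp (3 * ((d : ℝ) + 1) * W * δ) * Real.exp (-δ * l1 (u' - u))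
            * Real.exp (-δ * (l1 (x - u) + l1 (z - u))) := by
    intro x z μ α hz
    have hpos' : 0 ≤ C * Real.exp (3 * ((d : ℝ) + 1) * W * δ) * Real.exp (-δ * l1 (u' - u))
        * Real.exp (-δ * (l1 (x - u) + l1 (z - u))) :=
      mul_nonneg (mul_nonneg (mul_nonneg hC (Real.exp_pos _).le) (Real.exp_pos _).le) (Real.exp_pos _).le
    by_cases hx : x ∈ winF N W (AveragingContours.blk N z)
    · by_cases hu : u ∈ winF N W (AveragingContours.blk N z)
      · by_cases hu' : u' ∈ winF N W (AveragingContours.blk N z)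
        · have hz' : z ∈ winF N W (AveragingContours.blk N z) := by
            have h0 := smul_mem_winF (N := N) (W := W) (AveragingContours.blk N z)
            rwa [← AveragingHessianKernels.eq_smul_blk_of_off_eq_zero hN hz] at h0
          have d1 := l1_le_of_mem_winF hx hu
          have d2 := l1_le_of_mem_winF hz' hu
          have d3 := l1_le_of_mem_winF hu' hu
          have hW' : (0 : ℝ) ≤ (W : ℝ) := Nat.cast_nonneg W
          have hsum : δ * l1 (u' - u) + δ * (l1 (x - u) + l1 (z - u)) ≤ 3 * ((d : ℝ) + 1) * W * δ := by nlinarith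
          have h1 : 1 ≤ Real.exp (3 * ((d : ℝ) + 1) * W * δ) * Real.exp (-δ * l1 (u' - u))
              * Real.exp (-δ * (l1 (x - u) + l1 (z - u))) := by
            rw [← Real.exp_add, ← Real.exp_add]; exact Real.one_le_exp (by linarith)
          calc |K₂ μ (AveragingContours.blk N z) (α, x) (κ, u) (κ', u')| ≤ C * 1 := by rw [mul_one]; exact hb _ _ _ _ _
            _ ≤ C * (Real.exp (3 * ((d : ℝ) + 1) * W * δ) * Real.exp (-δ * l1 (u' - u))
                  * Real.exp (-δ * (l1 (x - u) + l1 (z - u)))) := mul_le_mul_of_nonneg_left h1 hC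
            _ = _ := by ring
        · rw [h₃ _ _ _ _ _ hu', abs_zero]; exact hpos'
      · rw [h₂ _ _ _ _ _ hu, abs_zero]; exact hpos'
    · rw [h₁ _ _ _ _ _ hx, abs_zero]; exact hpos'
  rcases a with α | μ <;> rcases b with α' | μ'
  · rw [AveragingHessianKernels.packVH_inl_inl, abs_zero]; exact hpos
  · rw [AveragingHessianKernels.packVH_inl_inr]
    split_ifs with hz
    · exact key x z μ' α hz
    · rw [abs_zero]; exact hpos
  · rw [AveragingHessianKernels.packVH_inr_inl]
    split_ifs with hx
    · rw [add_comm (l1 (x - u))]; exact key z x μ α' hx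
    · rw [abs_zero]; exact hpos
  · rw [AveragingHessianKernels.packVH_inr_inr, abs_zero]; exact hpos

/-- [folklore] **(LB)-SHAPE LOCALITY OF THE PACKED COMPOSITE SECOND-ORDER FAMILY AT EVERY RATE**:
`LocStencil₂ (compVh2S … m) (bndVH2 m · e^{3(d+1)·wid L m·δ}) δ`. -/
theorem locStencil₂_compVh2S (hL : 1 ≤ L) {Bℓ B𝓋 B𝓋₂ : ℝ} (hB : 0 ≤ Bℓ) (hB' : 0 ≤ B𝓋) (hB'' : 0 ≤ B𝓋₂)
    (hℓb : ∀ m μ y f, |ℓ m μ y f| ≤ Bℓ) (h𝓋b : ∀ m μ y f f', |𝓋 m μ y f f'| ≤ B𝓋) (h𝓋₂b : ∀ m μ y g g' g'', |𝓋₂ m μ y g g' g''| ≤ B𝓋₂)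
    (m : ℕ) {δ : ℝ} (hδ : 0 ≤ δ) :
    LocStencil₂ (compVh2S ℓ 𝓋 𝓋₂ L m) (bndVH2 d L Bℓ B𝓋 B𝓋₂ m * Real.exp (3 * ((d : ℝ) + 1) * (wid L m) * δ)) δ := by
  intro κ u κ' u'
  have hLm : 1 ≤ L ^ m := Nat.one_le_pow m L hL
  unfold compVh2S
  exact biLoc_packVH₂_of_window _ hLm (wid L m) (bndVH2_nonneg hB hB' hB'' m)
    (fun μ y f g h hh => compVH2Ker_eq_zero_fluct m g h hh) (fun μ y f g h hh => compVH2Ker_eq_zero_left m f h hh)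
    (fun μ y f g h hh => compVH2Ker_eq_zero_right m f g hh) (abs_compVH2Ker_le hB hB' hB'' hℓb h𝓋b h𝓋₂b m) hδ κ u κ' u'

/-- [folklore] `compVH2Ker … n` depends on the bricks `ℓ m`, `𝓋 m`, `𝓋₂ m`, `m < n`, only. -/
theorem compVH2Ker_congr {ℓ' : ℕ → Fin (d + 1) → Site (d + 1) → Bond (d + 1) → ℝ}
    {𝓋' : ℕ → Fin (d + 1) → Site (d + 1) → Bond (d + 1) → Bond (d + 1) → ℝ}
    {𝓋₂' : ℕ → Fin (d + 1) → Site (d + 1) → Bond (d + 1) → Bond (d + 1) → Bond (d + 1) → ℝ} :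
    ∀ (n : ℕ), (∀ m < n, ∀ μ y g, ℓ m μ y g = ℓ' m μ y g) → (∀ m < n, ∀ μ y g g', 𝓋 m μ y g g' = 𝓋' m μ y g g') →
      (∀ m < n, ∀ μ y g g' g'', 𝓋₂ m μ y g g' g'' = 𝓋₂' m μ y g g' g'') →
      ∀ (μ : Fin (d + 1)) (y : Site (d + 1)) (f b b' : Bond (d + 1)),
        compVH2Ker ℓ 𝓋 𝓋₂ L n μ y f b b' = compVH2Ker ℓ' 𝓋' 𝓋₂' L n μ y f b b'
  | 0, _, _, _, _, _, _, _, _ => rfl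
  | n + 1, h1, h2, h3, μ, y, f, b, b' => by
      rw [compVH2Ker_succ, compVH2Ker_succ]
      have hc : ∀ c g : Bond (d + 1), compLinKer ℓ L n c g = compLinKer ℓ' L n c g :=
        fun c g => compLinKer_congr n (fun m hm => h1 m (Nat.lt_succ_of_lt hm)) c g
      have hK : ∀ κ z (c c' : Bond (d + 1)), compVHKer ℓ 𝓋 L n κ z c c' = compVHKer ℓ' 𝓋' L n κ z c c' :=
        fun κ z c c' => compVHKer_congr n (fun m hm => h1 m (Nat.lt_succ_of_lt hm)) (fun m hm => h2 m (Nat.lt_succ_of_lt hm)) κ z c c'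
      have IH := compVH2Ker_congr n (fun m hm => h1 m (Nat.lt_succ_of_lt hm)) (fun m hm => h2 m (Nat.lt_succ_of_lt hm))
        (fun m hm => h3 m (Nat.lt_succ_of_lt hm))
      simp_rw [h3 n (Nat.lt_succ_self n), h2 n (Nat.lt_succ_self n), h1 n (Nat.lt_succ_self n), hc, hK, IH]

/-- [folklore] `compVh2S … n` depends on the bricks at levels `m < n` only (leaf-02 g29 W-7 (W2)). -/
theorem compVh2S_congr {ℓ' : ℕ → Fin (d + 1) → Site (d + 1) → Bond (d + 1) → ℝ}
    {𝓋' : ℕ → Fin (d + 1) → Site (d + 1) → Bond (d + 1) → Bond (d + 1) → ℝ}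
    {𝓋₂' : ℕ → Fin (d + 1) → Site (d + 1) → Bond (d + 1) → Bond (d + 1) → Bond (d + 1) → ℝ} (n : ℕ)
    (h1 : ∀ m < n, ∀ μ y g, ℓ m μ y g = ℓ' m μ y g) (h2 : ∀ m < n, ∀ μ y g g', 𝓋 m μ y g g' = 𝓋' m μ y g g')
    (h3 : ∀ m < n, ∀ μ y g g' g'', 𝓋₂ m μ y g g' g'' = 𝓋₂' m μ y g g' g'') :
    compVh2S ℓ 𝓋 𝓋₂ L n = compVh2S ℓ' 𝓋' 𝓋₂' L n := by
  funext κ u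
  have e : (fun μ y f f' => compVH2Ker ℓ 𝓋 𝓋₂ L n μ y f (κ, u) f') = (fun μ y f f' => compVH2Ker ℓ' 𝓋' 𝓋₂' L n μ y f (κ, u) f') := by
    funext μ y f f'; exact compVH2Ker_congr n h1 h2 h3 μ y f (κ, u) f'
  unfold compVh2S; rw [e]

/-! ## §3 (TB)-shape covariance of the packed family -/

/-- [folklore] node 7a's `packVH_translate` for a second-order family whose closed-over background bond moves with the translation. -/
theorem packVH₂_translate (K₂ : Fin (d + 1) → Site (d + 1) → Bond (d + 1) → Bond (d + 1) → Bond (d + 1) → ℝ) {N : ℕ} (hN : 1 ≤ N)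
    (hK : ∀ μ y t f g h, K₂ μ (y + t) (f.sh ((N : ℤ) • t)) (g.sh ((N : ℤ) • t)) (h.sh ((N : ℤ) • t)) = K₂ μ y f g h)
    (κ : Fin (d + 1)) (u : Site (d + 1)) (κ' : Fin (d + 1)) (u' t : Site (d + 1)) :
    packVH (fun μ y f f' => K₂ μ y f (κ, u + (N : ℤ) • t) f') N κ' (u' + (N : ℤ) • t)
      = shiftK (-((N : ℤ) • t)) (packVH (fun μ y f f' => K₂ μ y f (κ, u) f') N κ' u') := by
  funext x z a b
  simp only [shiftK]
  have e1 : ∀ w : Site (d + 1), w + -((N : ℤ) • t) = w + (N : ℤ) • (-t) := fun w => by rw [smul_neg]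
  have eκ : ((κ, u + (N : ℤ) • t) : Bond (d + 1)) = Bond.sh (κ, u) ((N : ℤ) • t) := rfl
  have eκ' : ∀ w : Site (d + 1), ((κ', w + (N : ℤ) • t) : Bond (d + 1)) = Bond.sh (κ', w) ((N : ℤ) • t) := fun w => rfl
  rcases a with α | μ <;> rcases b with α' | μ'
  · rfl
  · rw [AveragingHessianKernels.packVH_inl_inr, AveragingHessianKernels.packVH_inl_inr, e1, e1, AveragingHessianKernels.off_add_smul,
      AveragingHessianKernels.blk_add_smul hN]
    split_ifs with hz
    · have := hK μ' (AveragingContours.blk N z + -t) t (α, x + (N : ℤ) • -t) (κ, u) (κ', u')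
      rw [neg_add_cancel_right] at this
      rw [← this, eκ, eκ']
      congr 1; simp [Bond.sh, smul_neg]
    · rfl
  · rw [AveragingHessianKernels.packVH_inr_inl, AveragingHessianKernels.packVH_inr_inl, e1, e1, AveragingHessianKernels.off_add_smul,
      AveragingHessianKernels.blk_add_smul hN]
    split_ifs with hx
    · have := hK μ (AveragingContours.blk N x + -t) t (α', z + (N : ℤ) • -t) (κ, u) (κ', u')
      rw [neg_add_cancel_right] at this
      rw [← this, eκ, eκ']
      congr 1; simp [Bond.sh, smul_neg]
    · rfl
  · rfl

/-- [folklore] **(TB)-SHAPE COVARIANCE OF THE PACKED COMPOSITE SECOND-ORDER FAMILY** at blocking `L^m`. -/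
theorem compVh2S_translate (hL : 1 ≤ L)
    (hℓsh : ∀ m μ y t f, ℓ m μ (y + t) (f.sh ((L : ℤ) • t)) = ℓ m μ y f)
    (h𝓋sh : ∀ m μ y t f f', 𝓋 m μ (y + t) (f.sh ((L : ℤ) • t)) (f'.sh ((L : ℤ) • t)) = 𝓋 m μ y f f')
    (h𝓋₂sh : ∀ m μ y t g g' g'', 𝓋₂ m μ (y + t) (g.sh ((L : ℤ) • t)) (g'.sh ((L : ℤ) • t)) (g''.sh ((L : ℤ) • t)) = 𝓋₂ m μ y g g' g'')
    (m : ℕ) (κ : Fin (d + 1)) (u : Site (d + 1)) (κ' : Fin (d + 1)) (u' t : Site (d + 1)) :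
    compVh2S ℓ 𝓋 𝓋₂ L m κ (u + ((L ^ m : ℕ) : ℤ) • t) κ' (u' + ((L ^ m : ℕ) : ℤ) • t)
      = shiftK (-(((L ^ m : ℕ) : ℤ) • t)) (compVh2S ℓ 𝓋 𝓋₂ L m κ u κ' u') := by
  have hLm : 1 ≤ L ^ m := Nat.one_le_pow m L hL
  unfold compVh2S
  refine packVH₂_translate _ hLm (fun μ y t' f g h => ?_) κ u κ' u' t
  rw [Nat.cast_pow]
  exact compVH2Ker_sh hℓsh h𝓋sh h𝓋₂sh m f g h μ y t'

/-! ## §4 The two instantiations by name -/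

section Rooted

variable {r : ℕ → (Fin (d + 1) → ℕ)}

/-- [folklore] (R) ANCHOR: over an1's ROOTED bricks the depth-one composite second-order border kernel IS `vh2KerAt (toSite (r 0)) L`. -/
theorem compVH2Ker_rooted_one (hr : ∀ k, r k ∈ box (d + 1) L) (μ : Fin (d + 1)) (y : Site (d + 1)) (f b b' : Bond (d + 1)) :
    compVH2Ker (fun m => linKerAt (toSite (r m)) L) (fun m => vhKerAt (toSite (r m)) L) (fun m => vh2KerAt (toSite (r m)) L) L 1 μ y f b b'
      = vh2KerAt (toSite (r 0)) L μ y f b b' := by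
  refine compVH2Ker_one (fun m μ y g g' g'' h => ?_) (fun m μ y g g' g'' h => ?_) (fun m μ y g g' g'' h => ?_) μ y f b b'
  · show ((AveragingMixedJetTables.vh2Tab (toSite (r m)) L μ y g g' g'' : ℚ) : ℝ) = 0
    rw [AveragingMixedJetTables.vh2Tab_eq_zero₁ (hr m) μ y h g' g'', Rat.cast_zero]
  · show ((AveragingMixedJetTables.vh2Tab (toSite (r m)) L μ y g g' g'' : ℚ) : ℝ) = 0
    rw [AveragingMixedJetTables.vh2Tab_eq_zero₂ (hr m) μ y g h g'', Rat.cast_zero]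
  · show ((AveragingMixedJetTables.vh2Tab (toSite (r m)) L μ y g g' g'' : ℚ) : ℝ) = 0
    rw [AveragingMixedJetTables.vh2Tab_eq_zero₃ (hr m) μ y g g' h, Rat.cast_zero]

/-- [folklore] (R) ANCHOR AT THE STENCIL LEVEL: the depth-one packed family IS an1's `vh₂SAt (toSite (r 0)) L`. -/
theorem compVh2S_rooted_one (hr : ∀ k, r k ∈ box (d + 1) L) :
    compVh2S (fun m => linKerAt (toSite (r m)) L) (fun m => vhKerAt (toSite (r m)) L) (fun m => vh2KerAt (toSite (r m)) L) L 1
      = vh₂SAt (toSite (r 0)) L := by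
  funext κ u
  have e : (fun μ y f f' => compVH2Ker (fun m => linKerAt (toSite (r m)) L) (fun m => vhKerAt (toSite (r m)) L)
      (fun m => vh2KerAt (toSite (r m)) L) L 1 μ y f (κ, u) f') = (fun μ y f f' => vh2KerAt (toSite (r 0)) L μ y f (κ, u) f') := by
    funext μ y f f'
    exact compVH2Ker_rooted_one hr μ y f (κ, u) f'
  unfold compVh2S AveragingMixedJetTables.vh₂SAt
  rw [e, pow_one]

/-- [folklore] (R) (LB): the rooted composite second-order family at blocking `L^m` has the `LocStencil₂` body at every rate. -/
theorem locStencil₂_compVh2S_rooted (hL : 1 ≤ L) (hr : ∀ k, r k ∈ box (d + 1) L) {B₂ : ℝ} (hB₂ : 0 ≤ B₂)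
    (hB₂b : ∀ m, vh2Abs (toSite (r m)) L ≤ B₂) (m : ℕ) {δ : ℝ} (hδ : 0 ≤ δ) :
    LocStencil₂ (compVh2S (fun m => linKerAt (toSite (r m)) L) (fun m => vhKerAt (toSite (r m)) L) (fun m => vh2KerAt (toSite (r m)) L) L m)
      (bndVH2 d L (ell (d + 1) L : ℝ) (3 * (ell (d + 1) L : ℝ) ^ 2) B₂ m * Real.exp (3 * ((d : ℝ) + 1) * (wid L m) * δ)) δ :=
  locStencil₂_compVh2S hL (by positivity) (by positivity) hB₂
    (fun m μ y f => AveragingHessianKernelsRooted.abs_linKerAt_le hL μ y (hr m) f)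
    (fun m μ y f f' => AveragingHessianKernelsRooted.abs_vhKerAt_le hL μ y (hr m) f f')
    (fun m μ y g g' g'' => (AveragingMixedJetTables.abs_vh2Tab_le (hr m) μ y g g' g'').trans (hB₂b m)) m hδ

/-- [folklore] (R) (TB): block-translation covariance of the rooted composite second-order family at blocking `L^m`. -/
theorem compVh2S_rooted_translate (hL : 1 ≤ L) (m : ℕ) (κ : Fin (d + 1)) (u : Site (d + 1)) (κ' : Fin (d + 1)) (u' t : Site (d + 1)) :
    compVh2S (fun m => linKerAt (toSite (r m)) L) (fun m => vhKerAt (toSite (r m)) L) (fun m => vh2KerAt (toSite (r m)) L) L m κ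
        (u + ((L ^ m : ℕ) : ℤ) • t) κ' (u' + ((L ^ m : ℕ) : ℤ) • t)
      = shiftK (-(((L ^ m : ℕ) : ℤ) • t))
          (compVh2S (fun m => linKerAt (toSite (r m)) L) (fun m => vhKerAt (toSite (r m)) L) (fun m => vh2KerAt (toSite (r m)) L) L m κ u κ' u') :=
  compVh2S_translate hL (fun _ μ y t f => AveragingHessianKernelsRooted.linKerAt_add _ L μ y t f)
    (fun _ μ y t f f' => AveragingHessianKernelsRooted.vhKerAt_add _ L μ y t f f')
    (fun _ μ y t g g' g'' => AveragingMixedJetTables.vh2KerAt_add _ L μ y t g g' g'') m κ u κ' u' t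

end Rooted

section Sym

variable {r : Fin (d + 1) → ℕ}

/-- [folklore] (S) ANCHOR: over an1's (0.4)-SYMMETRISED bricks the depth-one composite second-order border kernel IS `symVh2KerAt (toSite r) L`. -/
theorem compVH2Ker_sym_one (hr : r ∈ box (d + 1) L) (μ : Fin (d + 1)) (y : Site (d + 1)) (f b b' : Bond (d + 1)) :
    compVH2Ker (fun _ => symLinKerAt (toSite r) L) (fun _ => symVhKerAt (toSite r) L) (fun _ => symVh2KerAt (toSite r) L) L 1 μ y f b b'
      = symVh2KerAt (toSite r) L μ y f b b' := by
  refine compVH2Ker_one (fun m μ y g g' g'' h => ?_) (fun m μ y g g' g'' h => ?_) (fun m μ y g g' g'' h => ?_) μ y f b b'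
  · show ((SymAveragingMixedJetTables.symVh2Tab (toSite r) L μ y g g' g'' : ℚ) : ℝ) = 0
    rw [SymAveragingMixedJetTables.symVh2Tab_eq_zero₁ hr μ y h g' g'', Rat.cast_zero]
  · show ((SymAveragingMixedJetTables.symVh2Tab (toSite r) L μ y g g' g'' : ℚ) : ℝ) = 0
    rw [SymAveragingMixedJetTables.symVh2Tab_eq_zero₂ hr μ y g h g'', Rat.cast_zero]
  · show ((SymAveragingMixedJetTables.symVh2Tab (toSite r) L μ y g g' g'' : ℚ) : ℝ) = 0
    rw [SymAveragingMixedJetTables.symVh2Tab_eq_zero₃ hr μ y g g' h, Rat.cast_zero]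

/-- [folklore] (S) ANCHOR AT THE STENCIL LEVEL: the depth-one packed family IS an1's `symVh₂SAt (toSite r) L`. -/
theorem compVh2S_sym_one (hr : r ∈ box (d + 1) L) :
    compVh2S (fun _ => symLinKerAt (toSite r) L) (fun _ => symVhKerAt (toSite r) L) (fun _ => symVh2KerAt (toSite r) L) L 1
      = symVh₂SAt (toSite r) L := by
  funext κ u
  have e : (fun μ y f f' => compVH2Ker (fun _ => symLinKerAt (toSite r) L) (fun _ => symVhKerAt (toSite r) L)
      (fun _ => symVh2KerAt (toSite r) L) L 1 μ y f (κ, u) f') = (fun μ y f f' => symVh2KerAt (toSite r) L μ y f (κ, u) f') := by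
    funext μ y f f'
    exact compVH2Ker_sym_one hr μ y f (κ, u) f'
  unfold compVh2S SymAveragingMixedJetTables.symVh₂SAt
  rw [e, pow_one]

/-- [folklore] (S) (LB): the symmetrised composite second-order family at blocking `L^m` has the `LocStencil₂` body at every rate. -/
theorem locStencil₂_compVh2S_sym (hL : 1 ≤ L) (hr : r ∈ box (d + 1) L) (m : ℕ) {δ : ℝ} (hδ : 0 ≤ δ) :
    LocStencil₂ (compVh2S (fun _ => symLinKerAt (toSite r) L) (fun _ => symVhKerAt (toSite r) L) (fun _ => symVh2KerAt (toSite r) L) L m)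
      (bndVH2 d L (ell (d + 1) L : ℝ) (3 * (ell (d + 1) L : ℝ) ^ 2) (symVh2Abs (toSite r) L) m
        * Real.exp (3 * ((d : ℝ) + 1) * (wid L m) * δ)) δ :=
  locStencil₂_compVh2S hL (by positivity) (by positivity) (SymAveragingMixedJetTables.symVh2Abs_nonneg _ L)
    (fun _ μ y f => SymAveragingHessianCounts.abs_symLinKerAt_le hL μ y hr f)
    (fun _ μ y f f' => SymAveragingHessianCounts.abs_symVhKerAt_le hL μ y hr f f')
    (fun _ μ y g g' g'' => SymAveragingMixedJetTables.abs_symVh2Tab_le hr μ y g g' g'') m hδ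

/-- [folklore] (S) (TB): block-translation covariance of the symmetrised composite second-order family at blocking `L^m`. -/
theorem compVh2S_sym_translate (hL : 1 ≤ L) (m : ℕ) (κ : Fin (d + 1)) (u : Site (d + 1)) (κ' : Fin (d + 1)) (u' t : Site (d + 1)) :
    compVh2S (fun _ => symLinKerAt (toSite r) L) (fun _ => symVhKerAt (toSite r) L) (fun _ => symVh2KerAt (toSite r) L) L m κ
        (u + ((L ^ m : ℕ) : ℤ) • t) κ' (u' + ((L ^ m : ℕ) : ℤ) • t)
      = shiftK (-(((L ^ m : ℕ) : ℤ) • t))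
          (compVh2S (fun _ => symLinKerAt (toSite r) L) (fun _ => symVhKerAt (toSite r) L) (fun _ => symVh2KerAt (toSite r) L) L m κ u κ' u') :=
  compVh2S_translate hL (fun _ μ y t f => SymAveragingHessianCounts.symLinKerAt_add _ L μ y t f)
    (fun _ μ y t f f' => SymAveragingHessianCounts.symVhKerAt_add _ L μ y t f f')
    (fun _ μ y t g g' g'' => SymAveragingMixedJetTables.symVh2KerAt_add _ L μ y t g g' g'') m κ u κ' u' t

end Sym

end Summit.QuantumFields.BalabanUV.Beta.CompositeVertexKernelRec

end
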